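import Literature.InformationTheory.QuantumCodes.TwistedToricWalks
import Mathlib.Algebra.Order.Interval.Finset.Basic
import HarnessLib

/-!
# Toric codes on twisted tori — the planar lemma: a finite cycle of the square grid `ℤ²` bounds

Topic `InformationTheory/QuantumCodes`; namespace `Literature.InformationTheory.QuantumCodes.TwistedToric`.
LADDER-QEC (cell `qec`), PARTITION row 08, item 08.TWIST (file 4 of the distance proof of `TwistedToricCodes.lean`).

Upstairs, on the universal cover: the infinite square grid is the Cayley graph of `(ℤ × ℤ; e1, e2)`,
`e1 = (1,0)`, `e2 = (0,1)`, with the SAME chain vocabulary (`star`, `face`, `wchain` of the previous files at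
`V = ℤ × ℤ`). **Planar lemma** (`planar_decomposition`): a finitely supported `1`-chain `D` of the grid with zero
star sum at every vertex (a cycle) is a finite sum of plaquette chains — explicitly
`D = Σ_{f ∈ box} S(f) • face f` with `S(i,j) =` the parity of the number of horizontal edges of `D` in column `i`
strictly above height `j` («inside = odd number of crossings above»). Ingredients: the column-parity lemma (every
column carries an even number of horizontal edges of a cycle, `colAbove_bottom`) and a telescoping identity. This
is the genus-zero fact `H₁(ℝ²) = 0` in the combinatorial form needed to push closed lifted walks down to
`Z`-stabilizers (`TwistedToricHomology.lean`).

Support is controlled by an explicit box `[-N, N]²` (`vInBox`/`eInBox`); faces range over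
`boxFaces N = [-N-1, N]²`. 0 named facts, no instances, no notation.

## References
* [DennisEtAl2002] Dennis–Kitaev–Landahl–Preskill, J. Math. Phys. 43 (2002), §3.1 (held chunk p0008 L1-5: on the
  plane / a planar code every cycle is homologically trivial — «the boundary of a two-chain», i.e. a product of
  plaquettes; the torus acquires non-trivial cycles only through its periodic identification).
* [KovalevPryadko2012] Kovalev–Pryadko, arXiv:1202.0928, §III.C (p0005 L53-60: the torus as the plane modulo the
  period lattice).
-/

namespace Literature.InformationTheory.QuantumCodes

open Matrix Finset

namespace TwistedToric

/-! ## The plane grid -/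

section Plane

/-- The first unit vector `(1, 0)` of the covering lattice `ℤ²`. (definition) [cite: KovalevPryadko2012, §III.C (p0005 L53-56: the square lattice and its translations)] -/
def e1 : ℤ × ℤ := (1, 0)

/-- The second unit vector `(0, 1)` of `ℤ²`. (definition) [cite: KovalevPryadko2012, §III.C (p0005 L53-56)] -/
def e2 : ℤ × ℤ := (0, 1)

/-- On the cover the relation map of `(e1, e2)` is the identity: `m₁•e1 + m₂•e2 = m`.
[cite: KovalevPryadko2012, §III.C (p0005 L53-56: integer coordinates of the covering lattice)] -/
theorem rel_e1_e2 (m : ℤ × ℤ) : rel e1 e2 m = m := by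
  ext <;> simp [rel_apply, e1, e2]

/-- A vertex of `ℤ²` lies in the box `[-N, N]²`. (definition) [cite: DennisEtAl2002, §3.1 (a finite patch of the square lattice)] -/
def vInBox (N : ℕ) (p : ℤ × ℤ) : Prop := -(N : ℤ) ≤ p.1 ∧ p.1 ≤ N ∧ -(N : ℤ) ≤ p.2 ∧ p.2 ≤ N

/-- An edge of the grid lies in the box: both endpoints do (`inl p : p → p + e1`, `inr p : p → p + e2`). (definition)
[cite: DennisEtAl2002, §3.1 (links of a finite patch)] -/
def eInBox (N : ℕ) : (ℤ × ℤ) ⊕ (ℤ × ℤ) → Prop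
  | .inl p => vInBox N p ∧ vInBox N (p + e1)
  | .inr p => vInBox N p ∧ vInBox N (p + e2)

/-- The faces summed over: lower-left corners in `[-N-1, N]²`. (definition) [cite: DennisEtAl2002, §3.1 (plaquettes of a finite patch)] -/
noncomputable def boxFaces (N : ℕ) : Finset (ℤ × ℤ) := Finset.Icc (-(N : ℤ) - 1) N ×ˢ Finset.Icc (-(N : ℤ) - 1) N

/-- **`S(i,j)`**: the parity of the number of horizontal edges of `D` in column `i` strictly above height `j`
(heights `j+1, …, N`). (definition) [cite: DennisEtAl2002, §3.1 (a planar cycle is the boundary of the set of plaquettes it encloses — parity of crossings)] -/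
noncomputable def colAbove (N : ℕ) (D : (ℤ × ℤ) ⊕ (ℤ × ℤ) → ZMod 2) (f : ℤ × ℤ) : ZMod 2 :=
  ∑ j' ∈ Finset.Ioc f.2 (N : ℤ), D (.inl (f.1, j'))

variable {N : ℕ} {D : (ℤ × ℤ) ⊕ (ℤ × ℤ) → ZMod 2}

/-- Outside the box the chain vanishes (contrapositive of the support hypothesis). [cite: DennisEtAl2002, §3.1 (finite error chains)] -/
theorem apply_eq_zero_of_not_inBox (hbox : ∀ e, D e ≠ 0 → eInBox N e) {e : (ℤ × ℤ) ⊕ (ℤ × ℤ)}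
    (he : ¬ eInBox N e) : D e = 0 := by
  by_contra h; exact he (hbox e h)

/-- `Ioc (j-1) N = insert j (Ioc j N)` for `j ≤ N` (integers). [cite: DennisEtAl2002, §3.1 (rows of the lattice)] -/
theorem Ioc_pred_eq_insert {j : ℤ} (hj : j ≤ N) :
    Finset.Ioc (j - 1) (N : ℤ) = insert j (Finset.Ioc j (N : ℤ)) := by
  ext x
  simp only [Finset.mem_Ioc, Finset.mem_insert]
  omega

/-- Telescoping in `𝔽₂`: `Σ_{j' ∈ (j, N]} (f j' + f (j'-1)) = f N + f j` for `j ≤ N`.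
[cite: DennisEtAl2002, §3.1 (ℤ₂ chains: interior contributions cancel in pairs)] -/
theorem sum_Ioc_telescope (f : ℤ → ZMod 2) {j : ℤ} (hj : j ≤ N) :
    ∑ j' ∈ Finset.Ioc j (N : ℤ), (f j' + f (j' - 1)) = f N + f j := by
  obtain ⟨k, rfl⟩ : ∃ k : ℕ, j = N - k := ⟨(N - j).toNat, by omega⟩
  induction k with
  | zero =>
    have h0 : Finset.Ioc ((N : ℤ) - (0 : ℕ)) (N : ℤ) = ∅ := by
      rw [Nat.cast_zero, sub_zero]; exact Finset.Ioc_self _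
    rw [h0, Finset.sum_empty, Nat.cast_zero, sub_zero, CharTwo.add_self_eq_zero]
  | succ k ih =>
    have hk : (N : ℤ) - k ≤ N := by omega
    have hset : Finset.Ioc ((N : ℤ) - (k + 1 : ℕ)) (N : ℤ) = insert ((N : ℤ) - k) (Finset.Ioc ((N : ℤ) - k) N) := by
      rw [← Ioc_pred_eq_insert hk]; congr 1; push_cast; ring
    rw [hset, Finset.sum_insert (by simp), ih hk]
    have e : ((N : ℤ) - (k + 1 : ℕ)) = (N : ℤ) - k - 1 := by push_cast; ring
    rw [e]
    calc f ((N : ℤ) - k) + f ((N : ℤ) - k - 1) + (f N + f ((N : ℤ) - k))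
        = (f ((N : ℤ) - k) + f ((N : ℤ) - k)) + (f N + f ((N : ℤ) - k - 1)) := by ring
      _ = f N + f ((N : ℤ) - k - 1) := by rw [CharTwo.add_self_eq_zero, zero_add]

/-- Peeling the top of a column sum: `S(i, j'-1) = D(i,j') + S(i,j')` for `j' ≤ N`.
[cite: DennisEtAl2002, §3.1 (crossing one more horizontal link flips the parity)] -/
theorem colAbove_pred {i j' : ℤ} (hj : j' ≤ N) :
    colAbove N D (i, j' - 1) = D (.inl (i, j')) + colAbove N D (i, j') := by
  simp only [colAbove]
  rw [Ioc_pred_eq_insert hj, Finset.sum_insert (by simp)]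

/-- Above the box the column sum is empty: `S(i,j) = 0` for `j ≥ N`. [cite: DennisEtAl2002, §3.1 (finite patch)] -/
theorem colAbove_eq_zero_of_le {i j : ℤ} (hj : (N : ℤ) ≤ j) : colAbove N D (i, j) = 0 := by
  simp only [colAbove]
  rw [Finset.Ioc_eq_empty (by omega), Finset.sum_empty]

/-- Outside the columns of the box every column sum vanishes. [cite: DennisEtAl2002, §3.1 (finite patch)] -/
theorem colAbove_eq_zero_of_col (hbox : ∀ e, D e ≠ 0 → eInBox N e) {i : ℤ} (hi : i < -(N : ℤ) ∨ (N : ℤ) < i)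
    (j : ℤ) : colAbove N D (i, j) = 0 := by
  simp only [colAbove]
  refine Finset.sum_eq_zero fun j' _ => apply_eq_zero_of_not_inBox hbox ?_
  simp only [eInBox, vInBox, e1, Prod.mk_add_mk]
  omega

/-- **Column parity**: a finite cycle has an even number of horizontal edges in every column —
`S(i, -N-1) = 0` (sum over the whole column). Proof: summing the star condition over the vertices of column `i+1`
inside the box gives `S(i+1,·) + S(i,·) + (telescoping vertical terms = 0)`, and columns right of the box are empty.
[cite: DennisEtAl2002, §3.1 (a planar cycle crosses every vertical line an even number of times)] -/
theorem colAbove_bottom (hbox : ∀ e, D e ≠ 0 → eInBox N e) (heven : ∀ p, star e1 e2 D p = 0) (i : ℤ) :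
    colAbove N D (i, -(N : ℤ) - 1) = 0 := by
  -- the recursion `S(i) = S(i+1)` for every `i`
  have hrec : ∀ i : ℤ, colAbove N D (i, -(N : ℤ) - 1) = colAbove N D (i + 1, -(N : ℤ) - 1) := by
    intro i
    have hsum : ∑ j' ∈ Finset.Ioc (-(N : ℤ) - 1) (N : ℤ), star e1 e2 D (i + 1, j') = 0 :=
      Finset.sum_eq_zero fun j' _ => heven _
    have hsplit : ∀ j', star e1 e2 D (i + 1, j') =
        (D (.inl (i + 1, j')) + D (.inl (i, j'))) + (D (.inr (i + 1, j')) + D (.inr (i + 1, j' - 1))) := by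
      intro j'
      simp only [star, e1, e2, Prod.mk_sub_mk, add_sub_cancel_right, sub_zero]
      ring
    simp_rw [hsplit] at hsum
    rw [Finset.sum_add_distrib, Finset.sum_add_distrib,
      sum_Ioc_telescope (fun j' => D (.inr (i + 1, j'))) (by omega)] at hsum
    have h1 : D (.inr (i + 1, (N : ℤ))) = 0 := apply_eq_zero_of_not_inBox hbox (by
      simp only [eInBox, vInBox, e2, Prod.mk_add_mk]; omega)
    have h2 : D (.inr (i + 1, -(N : ℤ) - 1)) = 0 := apply_eq_zero_of_not_inBox hbox (by
      simp only [eInBox, vInBox, e2, Prod.mk_add_mk]; omega)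
    rw [h1, h2, add_zero, add_zero] at hsum
    simp only [colAbove]
    exact (CharTwo.add_eq_zero.1 hsum).symm
  -- columns to the right of the box are empty; induct leftwards
  have hright : ∀ i : ℤ, (N : ℤ) < i → colAbove N D (i, -(N : ℤ) - 1) = 0 :=
    fun i hi => colAbove_eq_zero_of_col hbox (Or.inr hi) _
  by_cases hi : (N : ℤ) < i
  · exact hright i hi
  · obtain ⟨k, rfl⟩ : ∃ k : ℕ, i = N + 1 - k := ⟨(N + 1 - i).toNat, by omega⟩
    induction k with
    | zero => exact hright _ (by omega)
    | succ k ih =>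
      rw [hrec]
      have e : (N : ℤ) + 1 - (k + 1 : ℕ) + 1 = N + 1 - k := by push_cast; ring
      rw [e]
      by_cases hk : (N : ℤ) < N + 1 - k
      · exact hright _ hk
      · exact ih hk

/-- Below the box the column sum is the full column parity, hence `0`. [cite: DennisEtAl2002, §3.1 (finite patch)] -/
theorem colAbove_eq_zero_of_lt (hbox : ∀ e, D e ≠ 0 → eInBox N e) (heven : ∀ p, star e1 e2 D p = 0) {i j : ℤ}
    (hj : j ≤ -(N : ℤ) - 1) : colAbove N D (i, j) = 0 := by
  obtain ⟨k, rfl⟩ : ∃ k : ℕ, j = -(N : ℤ) - 1 - k := ⟨(-(N : ℤ) - 1 - j).toNat, by omega⟩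
  induction k with
  | zero => simpa using colAbove_bottom hbox heven i
  | succ k ih =>
    have e : -(N : ℤ) - 1 - (k + 1 : ℕ) = (-(N : ℤ) - 1 - k) - 1 := by push_cast; ring
    rw [e, colAbove_pred (by omega), ih (by omega)]
    rw [apply_eq_zero_of_not_inBox hbox (by simp only [eInBox, vInBox, e1, Prod.mk_add_mk]; omega), add_zero]

/-- `S` vanishes off `boxFaces N`. [cite: DennisEtAl2002, §3.1 (finite patch)] -/
theorem colAbove_eq_zero_of_not_mem (hbox : ∀ e, D e ≠ 0 → eInBox N e) (heven : ∀ p, star e1 e2 D p = 0)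
    {f : ℤ × ℤ} (hf : f ∉ boxFaces N) : colAbove N D f = 0 := by
  obtain ⟨i, j⟩ := f
  simp only [boxFaces, Finset.mem_product, Finset.mem_Icc, not_and_or, not_le] at hf
  rcases hf with (hi | hi) | (hj | hj)
  · exact colAbove_eq_zero_of_col hbox (Or.inl (by omega)) j
  · exact colAbove_eq_zero_of_col hbox (Or.inr hi) j
  · exact colAbove_eq_zero_of_lt hbox heven (by omega)
  · exact colAbove_eq_zero_of_le (by omega)

/-- A sum `Σ_{f ∈ box} S f · [x = f]` picks out `S x` when `S` vanishes off the box. [cite: DennisEtAl2002, §3.1 (finite patch)] -/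
theorem sum_mul_ite_eq (S : ℤ × ℤ → ZMod 2) (F : Finset (ℤ × ℤ)) (hS : ∀ f ∉ F, S f = 0) (x : ℤ × ℤ) :
    ∑ f ∈ F, S f * (if x = f then 1 else 0) = S x := by
  simp_rw [mul_ite, mul_one, mul_zero]
  rw [Finset.sum_ite_eq]
  split_ifs with hx
  · rfl
  · exact (hS x hx).symm

/-- **Planar lemma.** A finitely supported cycle of the square grid `ℤ²` is a sum of plaquette chains:
`D = Σ_{f ∈ boxFaces N} S(f) • face f`, `S(i,j)` = parity of the horizontal edges of `D` in column `i` above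
height `j`. [cite: DennisEtAl2002, §3.1 (chunk p0008 L1-5: a homologically trivial cycle is the boundary of a two-chain, i.e. a product of plaquette operators; on the plane every cycle is trivial)] -/
theorem planar_decomposition (hbox : ∀ e, D e ≠ 0 → eInBox N e) (heven : ∀ p, star e1 e2 D p = 0) :
    D = ∑ f ∈ boxFaces N, colAbove N D f • face e1 e2 f := by
  have hS := fun f (hf : f ∉ boxFaces N) => colAbove_eq_zero_of_not_mem hbox heven hf
  funext e
  rw [Finset.sum_apply]
  simp only [Pi.smul_apply, face, Pi.add_apply, Pi.single_apply, smul_eq_mul, mul_add, Finset.sum_add_distrib]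
  cases e with
  | inl p =>
    obtain ⟨i, j'⟩ := p
    simp only [Sum.inl.injEq, reduceCtorEq, if_false, mul_zero, Finset.sum_const_zero, add_zero]
    -- the two surviving sums: f = (i,j') and f + e2 = (i,j'), i.e. f = (i, j'-1)
    have h2 : ∀ f : ℤ × ℤ, ((i, j') = f + e2) ↔ ((i, j' - 1) = f) := by
      intro f; obtain ⟨a, b⟩ := f
      simp only [e2, Prod.mk_add_mk, add_zero, Prod.mk.injEq]
      omega
    simp_rw [h2]
    rw [sum_mul_ite_eq _ _ hS, sum_mul_ite_eq _ _ hS]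
    by_cases hj : j' ≤ (N : ℤ)
    · rw [colAbove_pred hj]
      have h0 := CharTwo.add_self_eq_zero (colAbove N D (i, j'))
      linear_combination (-1 : ZMod 2) * h0
    · rw [colAbove_eq_zero_of_le (by omega), colAbove_eq_zero_of_le (by omega), add_zero]
      exact apply_eq_zero_of_not_inBox hbox (by simp only [eInBox, vInBox, e1, Prod.mk_add_mk]; omega)
  | inr p =>
    obtain ⟨i, j⟩ := p
    simp only [Sum.inr.injEq, reduceCtorEq, if_false, mul_zero, Finset.sum_const_zero, zero_add]
    have h2 : ∀ f : ℤ × ℤ, ((i, j) = f + e1) ↔ ((i - 1, j) = f) := by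
      intro f; obtain ⟨a, b⟩ := f
      simp only [e1, Prod.mk_add_mk, add_zero, Prod.mk.injEq]
      omega
    simp_rw [h2]
    rw [sum_mul_ite_eq _ _ hS, sum_mul_ite_eq _ _ hS]
    by_cases hj : j ≤ (N : ℤ)
    · -- use the star condition along column `i` above `j`, then telescope the vertical edges
      have hcol : colAbove N D (i, j) + colAbove N D (i - 1, j)
          = ∑ j' ∈ Finset.Ioc j (N : ℤ), (D (.inr (i, j')) + D (.inr (i, j' - 1))) := by
        simp only [colAbove, ← Finset.sum_add_distrib]
        refine Finset.sum_congr rfl fun j' _ => ?_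
        have h := heven (i, j')
        simp only [star, e1, e2, Prod.mk_sub_mk, sub_zero] at h
        -- h : D(inl(i,j')) + D(inl(i-1,j')) + D(inr(i,j')) + D(inr(i,j'-1)) = 0
        have h' := CharTwo.add_eq_zero.1 (show (D (.inl (i, j')) + D (.inl (i - 1, j')))
          + (D (.inr (i, j')) + D (.inr (i, j' - 1))) = 0 by rw [← h]; ring)
        exact h'
      rw [hcol, sum_Ioc_telescope (fun j' => D (.inr (i, j'))) hj]
      rw [apply_eq_zero_of_not_inBox hbox (e := Sum.inr (i, (N : ℤ)))
        (by simp only [eInBox, vInBox, e2, Prod.mk_add_mk]; omega), zero_add]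
    · rw [colAbove_eq_zero_of_le (by omega), colAbove_eq_zero_of_le (by omega), add_zero]
      exact apply_eq_zero_of_not_inBox hbox (by simp only [eInBox, vInBox, e2, Prod.mk_add_mk]; omega)

end Plane

end TwistedToric

end Literature.InformationTheory.QuantumCodes
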